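import Mathlib
import Literature.NumberTheory.Transcendental.KZCalculus
import Literature.NumberTheory.Transcendental.SemialgebraicLineDeriv
import Summits.KontsevichZagierPeriods.KontsevichZagierPeriods.Theses.IsogenyCertificates
import Summits.KontsevichZagierPeriods.KontsevichZagierPeriods.Theorems.HermiteRigidityGenusTwoCycleTransferPushforwardDimOne
import Summits.KontsevichZagierPeriods.KontsevichZagierPeriods.Theorems.HermiteRigidityGenusTwoCycleTransferSemialgebraicInvFunOn
import Summits.KontsevichZagierPeriods.KontsevichZagierPeriods.Theorems.IsogenyCertificatesJLPairImages
import Summits.KontsevichZagierPeriods.KontsevichZagierPeriods.Theorems.IsogenyCertificatesJLPairSemialg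
import HarnessLib

/-!
# `JLPairIdentityX` (stmt-KontsevichZagierPeriods-14655, route IsogenyCertificates)

The Jacquet–Langlands period identity between the Shimura-curve quotient `X = X_0^{35}/⟨ω_5⟩`
(`y² = f_X(x) = −x(9x+4)(4x+1)(172x³+176x²+60x+7)`) and the modular quotient `C = X_0(35)/⟨w_7⟩`
(`w² = f_C(u) = (u²+4)(u+1)(u³−5u²+3u−19)`):
`[(−1/4,0), x dx/√f_X] ~ [(−∞,−1), (4+2u) du/√f_C]` in the Kontsevich–Zagier calculus.
The certificate is the explicit algebraic correspondence `Z ⊂ C × X` realising the (unique)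
homomorphism `φ_A : J_C → J_X` (degree 32) with tangent matrix `[[−10,−6],[4,2]]` — found in this
programme by solving the abelian differential equation in exact rational power series (item
evidence `REPORT.md`; no such correspondence was in print). The chain (10 move instances, all in
dimension one): integrand additivity along `Z` (`g_b + g_t = (4+2u)/√f_C`, the trace identity),
one change of variables along the big-oval branch `x_b` (a semialgebraic diffeomorphism
`(−∞,−1) → (−1/4,0)`), two domain additivities isolating the turning point `u_m` of the tiny-oval
branch `x_t`, two changes of variables along `x_t` on `(−∞,u_m)` and `(u_m,−1)` — with the same
image `(−4/9, x_t(u_m))` and opposite integrands — and integrand additivity cancelling them.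
`JLPairIdentityX_proof` concludes the route declaration by name.
-/

noncomputable section

namespace Summit.KontsevichZagierPeriods.IsogenyCertificates.JLPair

open Literature.Algebra.Polynomial

/-! ### The moves: `JLPairIdentityX` -/

section Moves

open Set MeasureTheory
open Literature.NumberTheory.Transcendental Literature.ModelTheory.ExponentialFields
open Summit.KontsevichZagierPeriods.HermiteRigidity.GenusTwoCycleTransfer
  (det_smul_id_fin_one hasFDerivAt_fin_one stub_pushforwardDimOne stub_semialgebraicInvFunOn)

/-- Two one-dimensional representations with the same domain and integrands agreeing on it are
KZ-equivalent (one identity change of variables). [cite: KontsevichZagier2001, §1.2 rule (2)] -/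
theorem rel_of_eqOn (s r : KZ.IntegralRep 1) (hd : s.domain = r.domain)
    (hi : EqOn s.integrand r.integrand s.domain) : KZ.of s - KZ.of r ∈ KZ.relations := by
  refine KZ.changeOfVariablesRel_subset_relations ⟨1, s, r, id,
    fun _ => (1 : ℝ) • ContinuousLinearMap.id ℝ (Fin 1 → ℝ), isSemialgebraicMapOn_id s.isSemialgebraic_domain,
    fun x _ => ?_, injOn_id _, by rw [image_id, hd], fun _ hx => ?_, rfl⟩
  · simpa using (hasFDerivWithinAt_id (𝕜 := ℝ) x s.domain)
  · rw [det_smul_id_fin_one, abs_one, mul_one, hi hx]; rfl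

/-- A representation whose domain is Lebesgue-null is a relation (`[s] = [s] + [s]` by rule 1a).
[cite: KontsevichZagier2001, §1.2 rule (1)] -/
theorem rel_of_null (s : KZ.IntegralRep 1) (h0 : volume s.domain = 0) : KZ.of s ∈ KZ.relations := by
  have h : KZ.of s - KZ.of s - KZ.of s ∈ KZ.relations :=
    KZ.domainAddRel_subset_relations ⟨1, s, s, s, (union_self _).symm, by rwa [inter_self],
      eqOn_refl _ _, eqOn_refl _ _, rfl⟩
  have : KZ.of s - KZ.of s - KZ.of s = -KZ.of s := by abel
  rw [this] at h
  simpa using KZ.relations.neg_mem h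

/-- A representation whose integrand vanishes on its domain is a relation (`[s] = [s] + [s]` by
rule 1b). [cite: KontsevichZagier2001, §1.2 rule (1)] -/
theorem rel_of_integrand_zero (s : KZ.IntegralRep 1) (h0 : EqOn s.integrand 0 s.domain) :
    KZ.of s ∈ KZ.relations := by
  have h : KZ.of s - KZ.of s - KZ.of s ∈ KZ.relations :=
    KZ.integrandAddRel_subset_relations ⟨1, s, s, s, rfl, rfl, fun _ hx => by
      simp [Pi.add_apply, h0 hx], rfl⟩
  have : KZ.of s - KZ.of s - KZ.of s = -KZ.of s := by abel
  rw [this] at h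
  simpa using KZ.relations.neg_mem h

/-- Images of coordinate sets under coordinate maps on `ℝ¹`. [folklore] -/
theorem image_fin_one (f : ℝ → ℝ) (S : Set ℝ) :
    (fun p : Fin 1 → ℝ => fun _ : Fin 1 => f (p 0)) '' {p | p 0 ∈ S} = {q | q 0 ∈ f '' S} := by
  ext q
  constructor
  · rintro ⟨p, hp, rfl⟩
    exact ⟨p 0, hp, rfl⟩
  · rintro ⟨x, hx, hq⟩
    refine ⟨fun _ => x, hx, ?_⟩
    funext i
    rw [Fin.fin_one_eq_zero i]
    exact hq

/-- The fibre `{p | p 0 = a} ⊆ ℝ¹` is a point, hence Lebesgue-null. [folklore] -/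
theorem volume_fibre_fin_one (a : ℝ) : volume {p : Fin 1 → ℝ | p 0 = a} = 0 := by
  have : {p : Fin 1 → ℝ | p 0 = a} = {fun _ => a} := by
    ext p
    simp only [mem_setOf_eq, mem_singleton_iff]
    constructor
    · intro h; funext i; rw [Fin.fin_one_eq_zero i, h]
    · intro h; rw [h]
  rw [this, measure_singleton]

/-- **`JLPairIdentityX`** (stmt-KontsevichZagierPeriods-14655): the Jacquet–Langlands period identity
`[(−1/4,0), x dx/√f_X] ~ [(−∞,−1), (4+2u) du/√f_C]` between `X = X_0^{35}/⟨ω_5⟩` and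
`C = X_0(35)/⟨w_7⟩` is a chain of Kontsevich–Zagier moves: integrand additivity along the explicit
correspondence `Z` (the trace identity `g_b + g_t = (4+2u)/√f_C`), one change of variables along the
big-oval branch `x_b` (a diffeomorphism `(−∞,−1) → (−1/4,0)`), domain additivity at the turning point
`u_m` and two changes of variables along the tiny-oval branch `x_t`, whose two pushed-forward pieces
cancel by integrand additivity. [evidence: stmt-KontsevichZagierPeriods-14655 REPORT.md §4] -/
theorem JLPairIdentityX_proof :
    Summit.KontsevichZagierPeriods.KontsevichZagierPeriods.Theses.IsogenyCertificates.JLPairIdentityX := by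
  unfold Summit.KontsevichZagierPeriods.KontsevichZagierPeriods.Theses.IsogenyCertificates.JLPairIdentityX
  intro r r' hrd hri hr'd hr'i
  -- the two domains
  set I : Set (Fin 1 → ℝ) := {p | p 0 < -1} with hI_def
  have hI : IsSemialgebraic ℚ I := hr'd ▸ r'.isSemialgebraic_domain
  have hIeq : I = {p : Fin 1 → ℝ | p 0 ∈ Iio (-1)} := rfl
  have hImeas : MeasurableSet I := by
    have := KZ.IntegralRep.measurableSet_domain_holds r'; rwa [hr'd] at this
  have hrdJ : r.domain = {q : Fin 1 → ℝ | q 0 ∈ Ioo (-1 / 4 : ℝ) 0} := by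
    rw [hrd]; ext q; simp only [mem_setOf_eq, mem_Ioo]
  have hri' : ∀ q ∈ r.domain, r.integrand q = q 0 / Real.sqrt (fX (q 0)) := fun _ hq => by
    rw [hri hq]; rfl
  have hr'i' : ∀ p ∈ r'.domain, r'.integrand p = (4 + 2 * p 0) / Real.sqrt (fC (p 0)) := fun _ hp => by
    rw [hr'i hp]; rfl
  -- the big branch as a map of ℝ¹
  set Φb : (Fin 1 → ℝ) → (Fin 1 → ℝ) := fun p _ => xb (p 0) with hΦb_def
  have hΦb_img : Φb '' I = r.domain := by
    rw [hrdJ, hIeq, hΦb_def, image_fin_one, image_xb]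
  have hΦb_sa : IsSemialgebraicMapOn ℚ I Φb := IsSemialgebraicMapOn.of_forall hI fun _ => semialg_xb hI
  have hinjb : InjOn Φb I := by
    intro p hp p' hp' h
    have h0 : xb (p 0) = xb (p' 0) := congrFun h 0
    have := strictMonoOn_xb.injOn hp hp' h0
    funext i; rw [Fin.fin_one_eq_zero i]; exact this
  have hderb : ∀ p ∈ I, HasFDerivWithinAt Φb (dxb (p 0) • ContinuousLinearMap.id ℝ (Fin 1 → ℝ)) I p :=
    fun p hp => (hasFDerivAt_fin_one xb (dxb (p 0)) p (hasDerivAt_xb (le_of_lt hp))).hasFDerivWithinAt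
  -- integrability of g_b on I, by change of variables from r
  have hint_b : IntegrableOn (fun p : Fin 1 → ℝ => gb (p 0)) I := by
    have h := (integrableOn_image_iff_integrableOn_abs_det_fderiv_smul volume hImeas hderb hinjb r.integrand).mp
      (by rw [hΦb_img]; exact r.integrableOn)
    refine h.congr_fun (fun p hp => ?_) hImeas
    have hp' : p 0 < -1 := hp
    have hq : Φb p ∈ r.domain := by rw [← hΦb_img]; exact mem_image_of_mem _ hp
    show |(dxb (p 0) • ContinuousLinearMap.id ℝ (Fin 1 → ℝ)).det| • r.integrand (Φb p) = gb (p 0)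
    rw [det_smul_id_fin_one, smul_eq_mul, hri' _ hq, abs_of_pos (dxb_pos hp'.le)]
    show dxb (p 0) * (xb (p 0) / Real.sqrt (fX (xb (p 0)))) = gb (p 0)
    rw [sqrt_fX_xb hp', gb]
    have hE := (E_pos hp'.le).ne'
    have hM := (Mb_pos_and_Mt_pos hp'.le).1.ne'
    have hf := (Real.sqrt_pos.mpr (fC_pos hp')).ne'
    field_simp
  -- the two summand representations on I
  set rb : KZ.IntegralRep 1 := ⟨I, fun p => gb (p 0), hI, semialg_gb hI, hint_b⟩ with hrb_def
  have hint_t : IntegrableOn (fun p : Fin 1 → ℝ => gt (p 0)) I := by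
    have h1 : IntegrableOn r'.integrand I := by rw [← hr'd]; exact r'.integrableOn
    refine (h1.sub hint_b).congr_fun (fun p hp => ?_) hImeas
    have hp' : p 0 < -1 := hp
    have hsum := gb_add_gt hp'
    rw [Pi.sub_apply, hr'i' p (by rw [hr'd]; exact hp)]
    linarith
  set rt : KZ.IntegralRep 1 := ⟨I, fun p => gt (p 0), hI, semialg_gt hI, hint_t⟩ with hrt_def
  -- move 1b: [r'] = [rb] + [rt]
  have hA : KZ.of r' - KZ.of rb - KZ.of rt ∈ KZ.relations := by
    refine KZ.integrandAddRel_subset_relations ⟨1, r', rb, rt, hr'd.symm ▸ rfl, hr'd.symm ▸ rfl,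
      fun p hp => ?_, rfl⟩
    have hp' : p 0 < -1 := by rw [hr'd] at hp; exact hp
    rw [hr'i' p hp, Pi.add_apply]
    exact (gb_add_gt hp').symm
  -- move 2 along x_b: [rb] = [sb]
  have hGb : IsSemialgebraicMapOn ℚ (Φb '' I) (Function.invFunOn Φb I) := stub_semialgebraicInvFunOn hΦb_sa hinjb
  have hGφb : ∀ p ∈ I, Function.invFunOn Φb I (Φb p) = p := fun _ hp => hinjb.leftInvOn_invFunOn hp
  obtain ⟨sb, hsbd, hsbi, hB⟩ := stub_pushforwardDimOne rb xb dxb (Function.invFunOn Φb I)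
    (semialg_xb hI) (semialg_dxb hI) (fun _ hp => hasDerivAt_xb (le_of_lt hp))
    (fun _ hp => (dxb_pos (le_of_lt hp)).ne') hGb hGφb
  -- identification of sb with r
  have hC : KZ.of sb - KZ.of r ∈ KZ.relations := by
    refine rel_of_eqOn sb r (hsbd.trans hΦb_img) fun _ hq => ?_
    rw [hsbd] at hq
    obtain ⟨p, hp, rfl⟩ := hq
    have hp' : p 0 < -1 := hp
    rw [hsbi p hp, hri' _ (by rw [← hΦb_img]; exact mem_image_of_mem _ hp), abs_of_pos (dxb_pos hp'.le)]
    show gb (p 0) / dxb (p 0) = xb (p 0) / Real.sqrt (fX (xb (p 0)))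
    rw [sqrt_fX_xb hp', gb]
    have hE := (E_pos hp'.le).ne'
    have hM := (Mb_pos_and_Mt_pos hp'.le).1.ne'
    have hf := (Real.sqrt_pos.mpr (fC_pos hp')).ne'
    have hd := (dxb_pos hp'.le).ne'
    field_simp
  -- move 1a twice: [rt] = [rt₁] + [rt₂], [rt₂] = [rZ] + [rt₂']
  set D1 : Set (Fin 1 → ℝ) := {p | p 0 < um} with hD1_def
  set D2 : Set (Fin 1 → ℝ) := {p | um ≤ p 0 ∧ p 0 < -1} with hD2_def
  set D2' : Set (Fin 1 → ℝ) := {p | um < p 0 ∧ p 0 < -1} with hD2'_def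
  set DZ : Set (Fin 1 → ℝ) := {p | p 0 = um} with hDZ_def
  have hD1 : IsSemialgebraic ℚ D1 := isSemialgebraic_left hI
  have hD2' : IsSemialgebraic ℚ D2' := isSemialgebraic_right hI
  have hDZ : IsSemialgebraic ℚ DZ := isSemialgebraic_mid hI
  have hD2eq : D2 = DZ ∪ D2' := by
    ext p; simp only [hD2_def, hDZ_def, hD2'_def, mem_setOf_eq, mem_union]
    constructor
    · rintro ⟨h1, h2⟩
      rcases eq_or_lt_of_le h1 with h | h
      · exact Or.inl h.symm
      · exact Or.inr ⟨h, h2⟩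
    · rintro (h | ⟨h1, h2⟩)
      · exact ⟨h.ge, by rw [h]; exact um_lt⟩
      · exact ⟨h1.le, h2⟩
  have hD2 : IsSemialgebraic ℚ D2 := by rw [hD2eq]; exact hDZ.union hD2'
  have hD1I : D1 ⊆ I := fun p hp => lt_trans (show p 0 < um from hp) um_lt
  have hD2I : D2 ⊆ I := fun _ hp => hp.2
  have hD2'2 : D2' ⊆ D2 := fun _ hp => ⟨hp.1.le, hp.2⟩
  have hDZ2 : DZ ⊆ D2 := fun p hp => ⟨(show p 0 = um from hp).ge, by rw [show p 0 = um from hp]; exact um_lt⟩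
  set rt₁ := rt.restrict D1 hD1 hD1I with hrt₁
  set rt₂ := rt.restrict D2 hD2 hD2I with hrt₂
  set rt₂' := rt₂.restrict D2' hD2' hD2'2 with hrt₂'
  set rZ := rt₂.restrict DZ hDZ hDZ2 with hrZ
  have hD : KZ.of rt - KZ.of rt₁ - KZ.of rt₂ ∈ KZ.relations := by
    refine KZ.domainAddRel_subset_relations ⟨1, rt, rt₁, rt₂, ?_, ?_, eqOn_refl _ _, eqOn_refl _ _, rfl⟩
    · show I = D1 ∪ D2
      ext p; simp only [hI_def, hD1_def, hD2_def, mem_setOf_eq, mem_union]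
      constructor
      · intro hp
        rcases lt_or_ge (p 0) um with h | h
        · exact Or.inl h
        · exact Or.inr ⟨h, hp⟩
      · rintro (h | ⟨_, h⟩)
        · exact lt_trans h um_lt
        · exact h
    · show volume (D1 ∩ D2) = 0
      have : D1 ∩ D2 = ∅ := by
        ext p; simp only [hD1_def, hD2_def, mem_inter_iff, mem_setOf_eq, mem_empty_iff_false, iff_false,
          not_and, not_lt]
        intro h1 h2; linarith
      rw [this, measure_empty]
  have hD' : KZ.of rt₂ - KZ.of rZ - KZ.of rt₂' ∈ KZ.relations := by
    refine KZ.domainAddRel_subset_relations ⟨1, rt₂, rZ, rt₂', hD2eq, ?_, eqOn_refl _ _, eqOn_refl _ _, rfl⟩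
    show volume (DZ ∩ D2') = 0
    have : DZ ∩ D2' = ∅ := by
      ext p; simp only [hDZ_def, hD2'_def, mem_inter_iff, mem_setOf_eq, mem_empty_iff_false, iff_false, not_and]
      intro h1 h2 _; rw [h1] at h2; exact lt_irrefl _ h2
    rw [this, measure_empty]
  have hZ : KZ.of rZ ∈ KZ.relations := rel_of_null rZ (volume_fibre_fin_one um)
  -- move 2 along x_t on the two pieces
  set Φt : (Fin 1 → ℝ) → (Fin 1 → ℝ) := fun p _ => xt (p 0) with hΦt_def
  have hinj1 : InjOn Φt D1 := by
    intro p hp p' hp' h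
    have h0 : xt (p 0) = xt (p' 0) := congrFun h 0
    have := strictMonoOn_xt.injOn (le_of_lt (show p 0 < um from hp)) (le_of_lt (show p' 0 < um from hp')) h0
    funext i; rw [Fin.fin_one_eq_zero i]; exact this
  have hinj2 : InjOn Φt D2' := by
    intro p hp p' hp' h
    have h0 : xt (p 0) = xt (p' 0) := congrFun h 0
    have := strictAntiOn_xt.injOn ⟨hp.1.le, hp.2.le⟩ ⟨hp'.1.le, hp'.2.le⟩ h0
    funext i; rw [Fin.fin_one_eq_zero i]; exact this
  have hΦt1_sa : IsSemialgebraicMapOn ℚ D1 Φt := IsSemialgebraicMapOn.of_forall hD1 fun _ => semialg_xt hD1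
  have hΦt2_sa : IsSemialgebraicMapOn ℚ D2' Φt := IsSemialgebraicMapOn.of_forall hD2' fun _ => semialg_xt hD2'
  have himg1 : Φt '' D1 = {q : Fin 1 → ℝ | q 0 ∈ Ioo (-4 / 9 : ℝ) (xt um)} := by
    rw [show D1 = {p : Fin 1 → ℝ | p 0 ∈ Iio um} from rfl, hΦt_def, image_fin_one, image_xt_left]
  have himg2 : Φt '' D2' = {q : Fin 1 → ℝ | q 0 ∈ Ioo (-4 / 9 : ℝ) (xt um)} := by
    rw [show D2' = {p : Fin 1 → ℝ | p 0 ∈ Ioo um (-1)} from rfl, hΦt_def, image_fin_one, image_xt_right]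
  obtain ⟨st₁, hst₁d, hst₁i, hE1⟩ := stub_pushforwardDimOne rt₁ xt dxt (Function.invFunOn Φt D1)
    (semialg_xt hD1) (semialg_dxt hD1) (fun _ hp => hasDerivAt_xt (le_of_lt (hD1I hp)))
    (fun _ hp => (dxt_pos hp).ne') (stub_semialgebraicInvFunOn hΦt1_sa hinj1)
    (fun _ hp => hinj1.leftInvOn_invFunOn hp)
  obtain ⟨st₂, hst₂d, hst₂i, hE2⟩ := stub_pushforwardDimOne rt₂' xt dxt (Function.invFunOn Φt D2')
    (semialg_xt hD2') (semialg_dxt hD2') (fun _ hp => hasDerivAt_xt (le_of_lt hp.2))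
    (fun _ hp => (dxt_neg hp.1 hp.2).ne) (stub_semialgebraicInvFunOn hΦt2_sa hinj2)
    (fun _ hp => hinj2.leftInvOn_invFunOn hp)
  -- the two pushed-forward pieces cancel: [st₁] + [st₂] ∈ relations
  have hst₁dom : st₁.domain = {q : Fin 1 → ℝ | q 0 ∈ Ioo (-4 / 9 : ℝ) (xt um)} := hst₁d.trans himg1
  have hst₂dom : st₂.domain = {q : Fin 1 → ℝ | q 0 ∈ Ioo (-4 / 9 : ℝ) (xt um)} := hst₂d.trans himg2
  have hst₁val : ∀ q ∈ st₁.domain, st₁.integrand q = q 0 / Real.sqrt (fX (q 0)) := fun _ hq => by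
    rw [hst₁d] at hq
    obtain ⟨p, hp, rfl⟩ := hq
    have hp' : p 0 < -1 := hD1I hp
    have hd : 0 < dxt (p 0) := dxt_pos hp
    rw [hst₁i p hp]
    show gt (p 0) / |dxt (p 0)| = xt (p 0) / Real.sqrt (fX (xt (p 0)))
    rw [abs_of_pos hd]
    have hE := (E_pos hp'.le).ne'
    have hM := (Mb_pos_and_Mt_pos hp'.le).2.ne'
    have hf := (Real.sqrt_pos.mpr (fC_pos hp')).ne'
    rw [sqrt_fX_xt hp', gt]
    field_simp
  have hst₂val : ∀ q ∈ st₂.domain, st₂.integrand q = -(q 0 / Real.sqrt (fX (q 0))) := fun _ hq => by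
    rw [hst₂d] at hq
    obtain ⟨p, hp, rfl⟩ := hq
    have hp' : p 0 < -1 := hp.2
    have hd : dxt (p 0) < 0 := dxt_neg hp.1 hp.2
    rw [hst₂i p hp]
    show gt (p 0) / |dxt (p 0)| = -(xt (p 0) / Real.sqrt (fX (xt (p 0))))
    rw [abs_of_neg hd]
    have hE := (E_pos hp'.le).ne'
    have hM := (Mb_pos_and_Mt_pos hp'.le).2.ne'
    have hf := (Real.sqrt_pos.mpr (fC_pos hp')).ne'
    have hd' := hd.ne
    rw [sqrt_fX_xt hp', gt]
    field_simp
  set Z0 : KZ.IntegralRep 1 := ⟨st₁.domain, fun _ => 0, st₁.isSemialgebraic_domain,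
    (isSemialgebraicFunOn_const_intCast st₁.isSemialgebraic_domain 0).congr fun _ _ => by simp,
    integrableOn_zero⟩ with hZ0_def
  have hF0 : KZ.of Z0 - KZ.of st₁ - KZ.of st₂ ∈ KZ.relations := by
    refine KZ.integrandAddRel_subset_relations ⟨1, Z0, st₁, st₂, rfl, hst₂dom.trans hst₁dom.symm,
      fun q hq => ?_, rfl⟩
    have hq1 : q ∈ st₁.domain := hq
    have hq2 : q ∈ st₂.domain := by rw [hst₂dom, ← hst₁dom]; exact hq
    rw [Pi.add_apply, hst₁val q hq1, hst₂val q hq2]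
    ring
  have hZ0 : KZ.of Z0 ∈ KZ.relations := rel_of_integrand_zero Z0 fun _ _ => rfl
  have hF : KZ.of st₁ + KZ.of st₂ ∈ KZ.relations := by
    have : KZ.of st₁ + KZ.of st₂ = KZ.of Z0 - (KZ.of Z0 - KZ.of st₁ - KZ.of st₂) := by abel
    rw [this]
    exact KZ.relations.sub_mem hZ0 hF0
  -- assembly
  have hB' := KZ.changeOfVariablesRel_subset_relations hB
  have hE1' := KZ.changeOfVariablesRel_subset_relations hE1
  have hE2' := KZ.changeOfVariablesRel_subset_relations hE2
  have key : KZ.of r' - KZ.of r = (KZ.of r' - KZ.of rb - KZ.of rt) + (KZ.of rb - KZ.of sb) + (KZ.of sb - KZ.of r)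
      + (KZ.of rt - KZ.of rt₁ - KZ.of rt₂) + (KZ.of rt₂ - KZ.of rZ - KZ.of rt₂') + KZ.of rZ
      + (KZ.of rt₁ - KZ.of st₁) + (KZ.of rt₂' - KZ.of st₂) + (KZ.of st₁ + KZ.of st₂) := by abel
  have hall : KZ.of r' - KZ.of r ∈ KZ.relations := by
    rw [key]
    refine KZ.relations.add_mem (KZ.relations.add_mem (KZ.relations.add_mem (KZ.relations.add_mem
      (KZ.relations.add_mem (KZ.relations.add_mem (KZ.relations.add_mem (KZ.relations.add_mem hA hB') hC) hD) hD')
      hZ) hE1') hE2') hF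
  show KZ.of r - KZ.of r' ∈ KZ.relations
  have : KZ.of r - KZ.of r' = -(KZ.of r' - KZ.of r) := by abel
  rw [this]
  exact KZ.relations.neg_mem hall

end Moves

end Summit.KontsevichZagierPeriods.IsogenyCertificates.JLPair

end
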